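import Summits.BirchSwinnertonDyer.BirchSwinnertonDyer.Theses.KatoDescentTamePotSupersingular
import Summits.BirchSwinnertonDyer.BirchSwinnertonDyer.Theorems.KatoDescentPotSupersingularReducibleKatoMemberNodes
import HarnessLib

/-!
# Route `KatoDescentTamePotSupersingular` (rung K8-t′, cell `bsd-potss`): the crux `ReducibleKatoMember`
# (item stmt-BirchSwinnertonDyer-19196, shared with K9) FROM KATO'S PUBLISHED INPUTS AT HIS MEMBER —
# thin route-typed restatement of the route-free node theorem
# `Theorems.ReducibleKatoMemberOfInputs.katoMemberShaBoundOfReducible_of_memberHullInputs`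

The crux M of the route is, by name, the cell's node
`Summit.BirchSwinnertonDyer.Rank1Residual.O6.KatoMemberShaBoundOfReducible` (T-X3K).  The route-free
module `KatoDescentPotSupersingularReducibleKatoMemberNodes.lean` derives it from the three named
Literature facts `Kato2004.nonempty_iwasawaH1Data` (Kato §12.2: the pinned `𝐇¹_Γ(T_pW)` exists),
`ModularForms.exists_isNewformOf` (modularity) and `Kato2004.exists_memberHullInputs` (Kato Thm. 12.4,
12.5 (1)–(3), 12.6 + 13.10 (1) + 13.14, §14.14, 14.5 (1)(2), 14.16 (2) + §14.8, Wuthrich L.14 at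
`T = V_{ℤ_p}(f)(1)`; p439134) through the proved hull descent
`Kato2004.valuation_add_padicValNat_coinvariants_le_of_hull_smul` (p437777).  This file only restates that
theorem with the K8-t′ route decl as its type, in the two shapes a planner's restatement can consume
(`facts → M` and `(facts ∧ …) → M`, K8 precedent `PublishedInputKO13`).  PROVENANCE: seat
`bsd-potss-rkm` generation 3 (staged P3), filed by seat `bsd-potss-kmc` generation 9.  CONDITIONAL
(audit `proof.conditional`); the item is NOT closed by this file.  HONEST FRAMING: BSD is not advanced;
M's non-CM rows remain "Kato's Euler-system bound at an additive prime with `E[p]` reducible", now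
resting on ONE named transcription of Kato's statements at his member.

References: [Kato2004Asterisque] Thm. 12.6 (p. 222), §14.14–14.15 (pp. 243–244), Prop. 14.16 (2)
(p. 244); [Wuthrich2014] Lemma 14; [GreenbergLNM1716] Prop. 4.13, §3; [Kim2022StructureSelmer] §3.2.3.
-/

set_option autoImplicit false
-- sibling precedent (`KatoDescentTamePotSupersingularAssembly.lean`): the directory name repeats the summit name
set_option linter.dupNamespace false

noncomputable section

namespace Summit.BirchSwinnertonDyer.BirchSwinnertonDyer.Theorems

open Literature.NumberTheory.EllipticCurves Literature.NumberTheory.EllipticCurves.ModularForms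
  Literature.NumberTheory.EllipticCurves.Kato2004

/-- **The K8-t′ crux `ReducibleKatoMember` (item stmt-BirchSwinnertonDyer-19196; type = the route decl
verbatim) from Kato's published inputs at his member**: `nonempty_iwasawaH1Data → exists_isNewformOf →
exists_memberHullInputs → ReducibleKatoMember`, by the route-free node theorem
`ReducibleKatoMemberOfInputs.katoMemberShaBoundOfReducible_of_memberHullInputs` (the route decl is
definitionally the node `O6.KatoMemberShaBoundOfReducible`).  Conditional on the three named Literature
facts; the item is not closed by this theorem (a restatement «inputs → M» would be).
[cite: Kato2004Asterisque, Thm. 12.6 (p. 222), §14.14 and Lemma 14.15 (pp. 243–244), Prop. 14.16 (2) (p. 244)]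
[cite: Wuthrich2014, Lemma 14 (p. 396)] -/
theorem tameReducibleKatoMember_of_memberHullInputs (hne : Kato2004.nonempty_iwasawaH1Data)
    (hmod : exists_isNewformOf) (hin : Kato2004.exists_memberHullInputs) :
    Summit.BirchSwinnertonDyer.BirchSwinnertonDyer.Theses.KatoDescentTamePotSupersingular.ReducibleKatoMember :=
  ReducibleKatoMemberOfInputs.katoMemberShaBoundOfReducible_of_memberHullInputs hne hmod hin

/-- **Conjunction form**: `(nonempty_iwasawaH1Data ∧ exists_isNewformOf ∧ exists_memberHullInputs) →
ReducibleKatoMember` (the closer of a planner's restatement «PublishedInputKatoMemberHull → M»).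
Conditional; nothing else assumed.
[cite: Kato2004Asterisque, Thm. 12.6 (p. 222), Prop. 14.16 (2) (p. 244)] [cite: Wuthrich2014, Lemma 14 (p. 396)] -/
theorem tameReducibleKatoMember_of_inputs_and
    (h : Kato2004.nonempty_iwasawaH1Data ∧ exists_isNewformOf ∧ Kato2004.exists_memberHullInputs) :
    Summit.BirchSwinnertonDyer.BirchSwinnertonDyer.Theses.KatoDescentTamePotSupersingular.ReducibleKatoMember :=
  ReducibleKatoMemberOfInputs.katoMemberShaBoundOfReducible_of_inputs_and h

end Summit.BirchSwinnertonDyer.BirchSwinnertonDyer.Theorems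

end
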